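/- Copyright: ym3-torus cell, WIDTH-5 ATTACH seat `ym-ust-19936-w4` (prover, g10), for crux `HistoryTailL` (stmt-QuantumFields-19936),
LINE `local_insertion` (#13, skeleton 48f0ac19), engine E2.  Released under the licence of the surrounding project. -/
import Summits.QuantumFields.YangMills.Theorems.UnitScaleTiltHistoryTailChessboardFamily
import HarnessLib

/-!
# LINE `local_insertion`, engine E2: the chessboard bound for ONE bounded INSERTION of the averaged plaquette variable

Support file (`--supports stmt-QuantumFields-19936 --as helper`) for LINE #13 `local_insertion` of crux `HistoryTailL`
(route `LocalInsertion`, card `Cruxes/HistoryTailL/Lines/local-insertion.md`).  The card's engine (E2) reads: «reflection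
positivity of the Wilson measure, inherited by block averages over reflection-compatible blocks, + the chessboard estimate
bound `E e^{εφ_a}` by exp(pressure shift of the reflection-periodised insertion)».  The tree's History chessboard road
(T⁴ cell; `ym-infvol-p3` files `…ChessboardTopField ∕ Mirror ∕ OnePlaquette ∕ Family ∕ T3`) proves the multiple-reflection
bound for EVENTS of the `j`-fold averaged plaquette variable under the `SU(n)` Wilson–Gibbs state.  This file is the
FUNCTION version — one bounded nonnegative INSERTION `g(dist1 Ū^j(∂p))` instead of an indicator:

  `∫ g(dist1 Ū^j(∂p)) dGibbs ≤ (∫ ∏_c g(dist1 Ū^j(∂(mirror p c))) dGibbs)^{1∕N^d}`       (general `P : Params`),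

with the separated mirror family through ANY plaquette (§5).  The 3-d `T3Family` letters and the LINE-13 reading (the
capped exponential insertion of both registered stubs) are drawn in the sequel file `…ChessboardInsertionBoundT3`.

WHAT.  §1 (abstract probability space) **`integral_le_rpow_of_rp`** — for cell observables `0 ≤ f c ≤ B`, positive-measurable
on positive halves and reflection-related, with the five RP fields at every block hyperplane: `∫ f c₀ ≤ (∫ ∏_c f c)^{1∕N^d}`,
INCLUDING the degenerate case `∫ ∏_c f c = 0` (homogeneity of the chessboard estimate makes the `[0,1]`-normalisation free; we run
the tree's `chessboardFields_of_isReflectionPositiveBdd` + `chessboard_le_rpow_even` on `(f c + ε)∕(B + ε)` and let `ε → 0⁺` by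
dominated convergence).  §2 **`towerLaw_integral_le_rpow_mirror`** (one top plaquette on the Gibbs TOWER); §3
**`gibbs_integral_iter_le_rpow_mirror`** (pulled back to the Gibbs state and `Averaging.iter`, `integral_towerLaw`); §4
**`gibbs_integral_iter_translate`** (integrals of readings of `Ū^K` are invariant under level-`K` translations); §5
**`exists_separated_mirror_family_integral`** (any plaquette: centre, mirror, translate back — as file 4 of the road).

HONEST SCOPE.  Soft finite-torus reflection-positivity bookkeeping over tree theorems; no estimate of Bałaban's papers is used or
asserted; nothing of the stubs, of `LocalInsertionL`, of `HistoryTailL` or of any crux is proved: E2's remaining content is the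
UV stability of the reflection-periodised insertion (the card's «Cor. 3 with shifted E±»), untouched here.  YM₃ on T³ is rung R3
of the ladder — not d = 4, not infinite volume, not a mass gap, not Clay. -/

namespace Summit.QuantumFields.YangMills.Theorems.LocalInsertion.ChessboardInsertion

open MeasureTheory Filter Topology Finset
open Literature.Barriers.CriticalPhenomena.NonGibbs Literature.Probability.LatticeModels
open Literature.MathematicalPhysics.QuantumFieldTheory
open Literature.MathematicalPhysics.QuantumFieldTheory.LatticeRP (IsReflectionPositiveBdd)
open Literature.MathematicalPhysics.QuantumFieldTheory.Balaban1983to89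
open BlockAveraging T4UndoubledRP
open Summit.QuantumFields.BalabanUV.T4Continuum
open HistoryRPHalfTorus HistoryRPTowerLaw HistoryRPTowerCuts HistoryChessboardRP HistoryChessboardTowerRepr
open HistoryChessboardEventsCubes HistoryChessboardEventsCubeSites HistoryChessboardPlaquetteBox
open Summit.QuantumFields.YangMills.Theorems.HistoryTailChessboardTopField
open Summit.QuantumFields.YangMills.Theorems.HistoryTailChessboardMirror
open Summit.QuantumFields.YangMills.Theorems.HistoryTailChessboardOnePlaquette
open Summit.QuantumFields.YangMills.Theorems.HistoryTailChessboardFamily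

noncomputable section

/-! ## §1 The chessboard bound for a reflection-related family of bounded nonnegative cell observables -/

section Abstract

variable {Ω : Type*} [m : MeasurableSpace Ω] {μ : Measure Ω} [IsProbabilityMeasure μ] {d N : ℕ} [NeZero N]

/-- the number of cells of the block torus `(ℤ∕N)^d` is `N^d`. [folklore] -/
theorem card_univ_blockIdx : (univ : Finset (BlockIdx d N)).card = N ^ d := by
  rw [card_univ]
  show Fintype.card (Fin d → ZMod N) = N ^ d
  rw [Fintype.card_fun, ZMod.card, Fintype.card_fin]

/-- **THE CHESSBOARD BOUND FOR ONE BOUNDED NONNEGATIVE CELL OBSERVABLE, ZERO CASE INCLUDED.**  On a probability space with,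
at every block hyperplane `(i, k)` of the block torus `(ℤ∕N)^d` (`N` even), a positive sub-σ-algebra `mP i k`, a measurable
measure-preserving involution `θ i k` and bounded reflection positivity of `μ` for `(mP i k, θ i k)`, a family of real cell
observables `f c` with `0 ≤ f c ≤ B`, positive-measurable on the positive halves and reflection-related
(`f c (θ i k ω) = f (cellReflect i k c) ω`) satisfies `∫ f c₀ ∂μ ≤ (∫ ∏_c f c ∂μ) ^ (1 ∕ N^d)`.  Proof: the tree's
`chessboardFields_of_isReflectionPositiveBdd` + `chessboard_le_rpow_even` for the `[0,1]`-valued cell observables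
`(f c + ε)∕(B + ε)` (whose full product has positive mean), the scale `(B + ε)` cancelling exactly because the estimate is
homogeneous of degree one; then `ε → 0⁺` (dominated convergence for the finite product). [folklore] -/
theorem integral_le_rpow_of_rp (mP : Fin d → ZMod N → MeasurableSpace Ω) (hmP : ∀ i k, mP i k ≤ m)
    (θ : Fin d → ZMod N → Ω → Ω) (hθm : ∀ i k, Measurable (θ i k))
    (hθ : ∀ i k, MeasurePreserving (θ i k) μ μ) (hθθ : ∀ i k, θ i k ∘ θ i k = id)
    (hRP : ∀ i k, IsReflectionPositiveBdd μ (mP i k) (θ i k)) (hN : Even N)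
    (f : BlockIdx d N → Ω → ℝ) (hfm : ∀ c, Measurable (f c))
    (hfP : ∀ (i : Fin d) (k : ZMod N), ∀ c ∈ halfPlus N i k, Measurable[mP i k] (f c))
    {B : ℝ} (hf0 : ∀ c ω, 0 ≤ f c ω) (hfB : ∀ c ω, f c ω ≤ B)
    (hcov : ∀ (i : Fin d) (k : ZMod N) (c : BlockIdx d N) (ω : Ω), f c (θ i k ω) = f (cellReflect i k c) ω)
    (c₀ : BlockIdx d N) :
    ∫ ω, f c₀ ω ∂μ ≤ (∫ ω, ∏ c, f c ω ∂μ) ^ ((1 : ℝ) / (N : ℝ) ^ d) := by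
  classical
  set r : ℝ := (1 : ℝ) / (N : ℝ) ^ d with hr_def
  have hNd : (0 : ℝ) < (N : ℝ) ^ d := by
    have : (0 : ℝ) < N := by exact_mod_cast Nat.pos_of_ne_zero (NeZero.ne N)
    positivity
  have hr : 0 < r := by rw [hr_def]; positivity
  have hcardR : ((univ : Finset (BlockIdx d N)).card : ℝ) = (N : ℝ) ^ d := by
    rw [card_univ_blockIdx]; push_cast; rfl
  -- a nonnegative bound
  set B' : ℝ := max B 0 with hB'_def
  have hB'0 : 0 ≤ B' := le_max_right _ _
  have hfB' : ∀ c ω, f c ω ≤ B' := fun c ω => (hfB c ω).trans (le_max_left _ _)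
  -- the shifted products and their integrals
  set F : ℝ → Ω → ℝ := fun ε ω => ∏ c, (f c ω + ε) with hF_def
  have hFm : ∀ ε, Measurable (F ε) := fun ε =>
    Finset.measurable_prod _ fun c _ => (hfm c).add_const ε
  have hF0 : ∀ ε, 0 ≤ ε → ∀ ω, 0 ≤ F ε ω := fun ε hε ω =>
    prod_nonneg fun c _ => add_nonneg (hf0 c ω) hε
  have hFle : ∀ ε, 0 ≤ ε → ∀ ω, F ε ω ≤ (B' + ε) ^ (univ : Finset (BlockIdx d N)).card := fun ε hε ω => by
    rw [← prod_const]
    exact Finset.prod_le_prod (fun c _ => add_nonneg (hf0 c ω) hε) fun c _ => by linarith [hfB' c ω]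
  have hFint : ∀ ε, 0 ≤ ε → Integrable (F ε) μ := fun ε hε =>
    Integrable.of_bound (hFm ε).aestronglyMeasurable ((B' + ε) ^ (univ : Finset (BlockIdx d N)).card)
      (ae_of_all _ fun ω => by
        rw [Real.norm_eq_abs, abs_of_nonneg (hF0 ε hε ω)]; exact hFle ε hε ω)
  have hI0 : ∀ ε, 0 ≤ ε → 0 ≤ ∫ ω, F ε ω ∂μ := fun ε hε => integral_nonneg (hF0 ε hε)
  have hfint : ∀ c, Integrable (f c) μ := fun c =>
    Integrable.of_bound (hfm c).aestronglyMeasurable B' (ae_of_all _ fun ω => by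
      rw [Real.norm_eq_abs, abs_of_nonneg (hf0 c ω)]; exact hfB' c ω)
  -- the estimate for every `ε > 0`
  have key : ∀ ε : ℝ, 0 < ε → ∫ ω, f c₀ ω ∂μ ≤ (∫ ω, F ε ω ∂μ) ^ r := by
    intro ε hε
    set C : ℝ := B' + ε with hC_def
    have hC : 0 < C := by rw [hC_def]; linarith
    -- the normalised cell observables
    set b : BlockIdx d N → Ω → ℝ := fun c ω => C⁻¹ * (f c ω + ε) with hb_def
    have hb0 : ∀ c ω, 0 ≤ b c ω := fun c ω =>
      mul_nonneg (inv_nonneg.2 hC.le) (add_nonneg (hf0 c ω) hε.le)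
    have hb1 : ∀ c ω, b c ω ≤ 1 := fun c ω => by
      show C⁻¹ * (f c ω + ε) ≤ 1
      rw [inv_mul_le_iff₀ hC, mul_one, hC_def]
      linarith [hfB' c ω]
    have hbm : ∀ c, Measurable (b c) := fun c => ((hfm c).add_const ε).const_mul _
    have hbP : ∀ (i : Fin d) (k : ZMod N), ∀ c ∈ halfPlus N i k, Measurable[mP i k] (b c) := fun i k c hc =>
      ((hfP i k c hc).add_const ε).const_mul _
    have hcovb : ∀ (i : Fin d) (k : ZMod N) (c : BlockIdx d N) (ω : Ω), b c (θ i k ω) = b (cellReflect i k c) ω := by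
      intro i k c ω
      simp only [hb_def, hcov i k c ω]
    set ψ : Finset (BlockIdx d N) → ℝ := fun S => ∫ ω, ∏ c ∈ S, b c ω ∂μ with hψ_def
    obtain ⟨h0, hempty, hcs⟩ := chessboardFields_of_isReflectionPositiveBdd mP hmP θ hθm hθ hθθ hRP hN b hbP hb0 hb1
      hcovb ψ (fun S => rfl)
    -- the full product of the normalised observables
    have hprod : ∀ ω, ∏ c, b c ω = C⁻¹ ^ (univ : Finset (BlockIdx d N)).card * F ε ω := by
      intro ω
      simp only [hb_def, hF_def]
      rw [prod_mul_distrib, prod_const]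
    have hψu : ψ univ = C⁻¹ ^ (univ : Finset (BlockIdx d N)).card * ∫ ω, F ε ω ∂μ := by
      show ∫ ω, ∏ c ∈ univ, b c ω ∂μ = _
      simp_rw [hprod]
      exact integral_const_mul _ _
    -- positivity of the full product mean: `ψ univ ≥ (C⁻¹ ε)^{#cells} > 0`
    have h1 : 0 < ψ univ := by
      rw [hψu]
      refine mul_pos (pow_pos (inv_pos.2 hC) _) ?_
      have hle : ∫ _ω, ε ^ (univ : Finset (BlockIdx d N)).card ∂μ ≤ ∫ ω, F ε ω ∂μ := by
        refine integral_mono (integrable_const _) (hFint ε hε.le) fun ω => ?_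
        show ε ^ (univ : Finset (BlockIdx d N)).card ≤ ∏ c, (f c ω + ε)
        rw [← prod_const]
        exact Finset.prod_le_prod (fun c _ => hε.le) fun c _ => le_add_of_nonneg_left (hf0 c ω)
      rw [integral_const, smul_eq_mul, probReal_univ, one_mul] at hle
      exact lt_of_lt_of_le (pow_pos hε _) hle
    -- the chessboard estimate at `S = {c₀}`
    have hcb := chessboard_le_rpow_even hN h0 hempty h1 hcs {c₀}
    rw [card_singleton, Nat.cast_one] at hcb
    have hψ0 : ψ {c₀} = C⁻¹ * (∫ ω, f c₀ ω ∂μ + ε) := by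
      show ∫ ω, ∏ c ∈ ({c₀} : Finset (BlockIdx d N)), b c ω ∂μ = _
      simp only [prod_singleton, hb_def]
      rw [integral_const_mul, integral_add (hfint c₀) (integrable_const ε), integral_const, smul_eq_mul,
        probReal_univ, one_mul]
    have hψur : ψ univ ^ r = C⁻¹ * (∫ ω, F ε ω ∂μ) ^ r := by
      rw [hψu, Real.mul_rpow (pow_nonneg (inv_nonneg.2 hC.le) _) (hI0 ε hε.le)]
      congr 1
      rw [← Real.rpow_natCast, ← Real.rpow_mul (inv_nonneg.2 hC.le), hcardR, hr_def,
        mul_one_div_cancel hNd.ne', Real.rpow_one]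
    rw [hψ0, hψur] at hcb
    have hcb' : ∫ ω, f c₀ ω ∂μ + ε ≤ (∫ ω, F ε ω ∂μ) ^ r := le_of_mul_le_mul_left hcb (inv_pos.2 hC)
    linarith
  -- `ε → 0⁺`: dominated convergence for the finite product, continuity of `x ↦ x^r`
  have hlimF : Tendsto (fun ε : ℝ => ∫ ω, F ε ω ∂μ) (𝓝[>] 0) (𝓝 (∫ ω, F 0 ω ∂μ)) := by
    refine tendsto_integral_filter_of_dominated_convergence
      (fun _ => (B' + 1) ^ (univ : Finset (BlockIdx d N)).card) ?_ ?_ (integrable_const _) ?_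
    · exact Eventually.of_forall fun ε => (hFm ε).aestronglyMeasurable
    · filter_upwards [Ioo_mem_nhdsGT (zero_lt_one : (0 : ℝ) < 1)] with ε hε
      refine ae_of_all _ fun ω => ?_
      rw [Real.norm_eq_abs, abs_of_nonneg (hF0 ε hε.1.le ω)]
      refine (hFle ε hε.1.le ω).trans ?_
      exact pow_le_pow_left₀ (by linarith [hε.1]) (by linarith [hε.2]) _
    · refine ae_of_all _ fun ω => ?_
      have hcont : Tendsto (fun ε : ℝ => F ε ω) (𝓝 0) (𝓝 (F 0 ω)) := by
        simp only [hF_def]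
        refine tendsto_finsetProd _ fun c _ => ?_
        exact ((continuous_const.add continuous_id).tendsto' 0 (f c ω + 0) (by simp))
      exact tendsto_nhdsWithin_of_tendsto_nhds hcont
  have hF00 : ∫ ω, F 0 ω ∂μ = ∫ ω, ∏ c, f c ω ∂μ := by
    simp only [hF_def, add_zero]
  have hlim : Tendsto (fun ε : ℝ => (∫ ω, F ε ω ∂μ) ^ r) (𝓝[>] 0) (𝓝 ((∫ ω, ∏ c, f c ω ∂μ) ^ r)) := by
    rw [← hF00]
    exact ((Real.continuousAt_rpow_const _ r (Or.inr hr.le)).tendsto).comp hlimF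
  refine ge_of_tendsto hlim ?_
  filter_upwards [self_mem_nhdsWithin] with ε hε
  exact key ε hε

end Abstract

/-! ## §2 One top plaquette of the `SU(n)` Gibbs tower of block averagings: a bounded insertion -/

section Tower

variable {P : Params} {n : ℕ} [NeZero n] {K M N : ℕ} [NeZero N]

/-- **THE MULTIPLE-REFLECTION BOUND FOR ONE BOUNDED INSERTION OF A TOP-PLAQUETTE VARIABLE ON THE GIBBS TOWER.**  For the
`SU(n)` Wilson–Gibbs state at `β ≥ 0` on Bałaban's torus `P`, measurable small-loop averages `ℰ k`, a height `K ≤ m + K_P`,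
the cube torus of the top lattice (`sitesPerDir K = M·N`, `N` even), a measurable `g : ℝ → ℝ` with `0 ≤ g ≤ B` and a top
plaquette `p` whose far corners lie in its cube: under the tower law of `(U, Ū, …, Ū^K)`,
`∫ g(dist1 Ū^K(∂p)) ≤ (∫ ∏_c g(dist1 Ū^K(∂(mirror p c))))^{1∕N^d}`. [folklore] -/
theorem towerLaw_integral_le_rpow_mirror (P : Params) {β : ℝ} (hβ : 0 ≤ β)
    (ℰ : ℕ → LoopAverage (Matrix.specialUnitaryGroup (Fin n) ℂ))
    (hE : ∀ k l, Measurable fun W : Fin (l + 1) → Matrix.specialUnitaryGroup (Fin n) ℂ => (ℰ k).E W)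
    (K : ℕ) (hK : K ≤ P.m + P.K) (h : P.sitesPerDir K = M * N) (hN : Even N)
    {g : ℝ → ℝ} (hgm : Measurable g) {B : ℝ} (hg0 : ∀ x, 0 ≤ g x) (hgB : ∀ x, g x ≤ B)
    (p : Plaq P K) (hp : ∀ j : Fin P.d, baseOffset M p j + extent p j < M) :
    ∫ ω, g (dist1 (GaugeField.plaqHol (last K ω) p))
        ∂(towerLaw (T4GenFunBounds.gibbsMeasure (G := Matrix.specialUnitaryGroup (Fin n) ℂ) P β)
          (fun k => blockAvg (P := P) (j := k) (ℰ k)) K) ≤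
      (∫ ω, ∏ c : BlockIdx P.d N, g (dist1 (GaugeField.plaqHol (last K ω) (mirror h hN p c)))
        ∂(towerLaw (T4GenFunBounds.gibbsMeasure (G := Matrix.specialUnitaryGroup (Fin n) ℂ) P β)
          (fun k => blockAvg (P := P) (j := k) (ℰ k)) K)) ^ ((1 : ℝ) / (N : ℝ) ^ P.d) := by
  set G := Matrix.specialUnitaryGroup (Fin n) ℂ
  haveI := T4GenFunBounds.isProbabilityMeasure_gibbsMeasure (G := G) P hβ
  have hA : ∀ k, Measurable (blockAvg (P := P) (j := k) (ℰ k)).avg := fun k => measurable_avgFun (ℰ k) (hE k)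
  haveI := isProbabilityMeasure_towerLaw (T4GenFunBounds.gibbsMeasure (G := G) P β)
    (fun k => blockAvg (P := P) (j := k) (ℰ k)) hA K
  obtain ⟨hmP, hθm, hθ, hθθ, hRP⟩ := cutoffRP_towerLaw_gibbs_SU_cubes (n := n) P hβ ℰ hE K hK h
  -- the cell observables
  set f : BlockIdx P.d N → Tower P G K → ℝ :=
    fun c ω => g (dist1 (GaugeField.plaqHol (last K ω) (mirror h hN p c))) with hf_def
  have hfm : ∀ c, Measurable (f c) := fun c =>
    hgm.comp (RegularGaugeGroup.measurable_dist1.comp ((Missing.measurable_plaqHol _).comp (measurable_last K)))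
  have hfP : ∀ (i : Fin P.d) (k : ZMod N), ∀ c ∈ halfPlus N i k, Measurable[cubePos G h i k] (f c) :=
    fun i k c hc => hgm.comp (measurable_dist1_plaqHol_last_cubePos (G := G) h hc (mirror_corners_mem h hN hp c))
  have hcov : ∀ (i : Fin P.d) (k : ZMod N) (c : BlockIdx P.d N) (ω : Tower P G K),
      f c (cubeRefl h i k ω) = f (cellReflect i k c) ω := by
    intro i k c ω
    simp only [hf_def]
    rw [dist1_plaqHol_last_cubeRefl, cutPlaq_mirror h hN hp]
  have main := integral_le_rpow_of_rp (μ := towerLaw (T4GenFunBounds.gibbsMeasure (G := G) P β)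
    (fun k => blockAvg (P := P) (j := k) (ℰ k)) K) (cubePos G h) hmP (cubeRefl h) hθm hθ hθθ hRP hN f hfm hfP
    (fun c ω => hg0 _) (fun c ω => hgB _) hcov (cubeOf M N p.src)
  have e0 : f (cubeOf M N p.src) = fun ω => g (dist1 (GaugeField.plaqHol (last K ω) p)) := by
    simp only [hf_def, mirror_cubeOf h hN hp]
  exact e0 ▸ main

end Tower

/-! ## §3 Pulled back to the Gibbs state and the `K`-fold average -/

section Gibbs

variable {P : Params} {n : ℕ} [NeZero n] {K M N : ℕ} [NeZero N]

/-- **THE MULTIPLE-REFLECTION BOUND FOR ONE BOUNDED INSERTION OF AN AVERAGED-PLAQUETTE VARIABLE UNDER THE GIBBS STATE** —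
the currency of engine E2: for the `SU(n)` Wilson–Gibbs state at `β ≥ 0` on Bałaban's torus, the `K`-fold block average
`Ū^K = Averaging.iter (blockAvg ∘ ℰ) K U`, a measurable `g : ℝ → ℝ` with `0 ≤ g ≤ B` and a top plaquette `p` whose far corners
lie in its cube of the cube torus (`sitesPerDir K = M·N`, `N` even):
`∫ g(dist1 Ū^K(∂p)) dGibbs ≤ (∫ ∏_c g(dist1 Ū^K(∂(mirror p c))) dGibbs) ^ (1 ∕ N^d)`. [folklore] -/
theorem gibbs_integral_iter_le_rpow_mirror (P : Params) {β : ℝ} (hβ : 0 ≤ β)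
    (ℰ : ℕ → LoopAverage (Matrix.specialUnitaryGroup (Fin n) ℂ))
    (hE : ∀ k l, Measurable fun W : Fin (l + 1) → Matrix.specialUnitaryGroup (Fin n) ℂ => (ℰ k).E W)
    (K : ℕ) (hK : K ≤ P.m + P.K) (h : P.sitesPerDir K = M * N) (hN : Even N)
    {g : ℝ → ℝ} (hgm : Measurable g) {B : ℝ} (hg0 : ∀ x, 0 ≤ g x) (hgB : ∀ x, g x ≤ B)
    (p : Plaq P K) (hp : ∀ j : Fin P.d, baseOffset M p j + extent p j < M) :
    ∫ U, g (dist1 (GaugeField.plaqHol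
        (Averaging.iter (fun k => blockAvg (P := P) (j := k) (ℰ k)) K U) p))
        ∂(T4GenFunBounds.gibbsMeasure (G := Matrix.specialUnitaryGroup (Fin n) ℂ) P β) ≤
      (∫ U, ∏ c : BlockIdx P.d N, g (dist1 (GaugeField.plaqHol
        (Averaging.iter (fun k => blockAvg (P := P) (j := k) (ℰ k)) K U) (mirror h hN p c)))
        ∂(T4GenFunBounds.gibbsMeasure (G := Matrix.specialUnitaryGroup (Fin n) ℂ) P β)) ^
        ((1 : ℝ) / (N : ℝ) ^ P.d) := by
  set G := Matrix.specialUnitaryGroup (Fin n) ℂ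
  have hA : ∀ k, Measurable (blockAvg (P := P) (j := k) (ℰ k)).avg := fun k => measurable_avgFun (ℰ k) (hE k)
  have hm₁ : Measurable fun ω : Tower P G K => g (dist1 (GaugeField.plaqHol (last K ω) p)) :=
    hgm.comp (RegularGaugeGroup.measurable_dist1.comp ((Missing.measurable_plaqHol _).comp (measurable_last K)))
  have hm₂ : Measurable fun ω : Tower P G K =>
      ∏ c : BlockIdx P.d N, g (dist1 (GaugeField.plaqHol (last K ω) (mirror h hN p c))) :=
    Finset.measurable_prod _ fun c _ =>
      hgm.comp (RegularGaugeGroup.measurable_dist1.comp ((Missing.measurable_plaqHol _).comp (measurable_last K)))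
  have h1 := integral_towerLaw (T4GenFunBounds.gibbsMeasure (G := G) P β) _ hA K hm₁
  have h2 := integral_towerLaw (T4GenFunBounds.gibbsMeasure (G := G) P β) _ hA K hm₂
  simp only [last_towerPt] at h1 h2
  rw [← h1, ← h2]
  exact towerLaw_integral_le_rpow_mirror P hβ ℰ hE K hK h hN hgm hg0 hgB p hp

end Gibbs

/-! ## §4 Integrals of readings of `Ū^K` are invariant under translations of the reading -/

section Invariance

variable {P : Params} {n : ℕ} [NeZero n]

/-- **TRANSLATING THE READING OF `Ū^K` DOES NOT CHANGE ITS GIBBS INTEGRAL**: `∫ Φ(τ_b Ū^K) dGibbs = ∫ Φ(Ū^K) dGibbs` for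
every measurable real reading `Φ` and every level-`K` vector `b` (the Gibbs state is invariant under the fine translation
`L^K·b`, `measurePreserving_gibbsMeasure_of_isExpectSymmetry`; the averagings intertwine it with `τ_b`, `T4Continuum.iter_translate`
over `blockAvg_translate`). [folklore] -/
theorem gibbs_integral_iter_translate (P : Params) {β : ℝ} (hβ : 0 ≤ β)
    (ℰ : ℕ → LoopAverage (Matrix.specialUnitaryGroup (Fin n) ℂ))
    (hE : ∀ k l, Measurable fun W : Fin (l + 1) → Matrix.specialUnitaryGroup (Fin n) ℂ => (ℰ k).E W)
    (K : ℕ) {Φ : GaugeField P K (Matrix.specialUnitaryGroup (Fin n) ℂ) → ℝ} (hΦ : Measurable Φ) (b : Site P K) :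
    ∫ U, Φ ((Averaging.iter (fun k => blockAvg (P := P) (j := k) (ℰ k)) K U).translate b)
        ∂(T4GenFunBounds.gibbsMeasure (G := Matrix.specialUnitaryGroup (Fin n) ℂ) P β) =
      ∫ U, Φ (Averaging.iter (fun k => blockAvg (P := P) (j := k) (ℰ k)) K U)
        ∂(T4GenFunBounds.gibbsMeasure (G := Matrix.specialUnitaryGroup (Fin n) ℂ) P β) := by
  have hA : ∀ k, Measurable (blockAvg (P := P) (j := k) (ℰ k)).avg := fun k => measurable_avgFun (ℰ k) (hE k)
  have hiter : Measurable (Averaging.iter (fun k => blockAvg (P := P) (j := k) (ℰ k)) K) :=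
    T4Continuum.measurable_iter _ hA K
  have hT : MeasurePreserving (GaugeField.translate (G := Matrix.specialUnitaryGroup (Fin n) ℂ) (Site.scaleTo K b))
      (T4GenFunBounds.gibbsMeasure (G := Matrix.specialUnitaryGroup (Fin n) ℂ) P β)
      (T4GenFunBounds.gibbsMeasure (G := Matrix.specialUnitaryGroup (Fin n) ℂ) P β) :=
    HistoryRPGibbsState.measurePreserving_gibbsMeasure_of_isExpectSymmetry hβ (measurable_translate _)
      (Missing.IsExpectSymmetry.translate _)
  have e : ∀ U : GaugeField P 0 (Matrix.specialUnitaryGroup (Fin n) ℂ),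
      (Averaging.iter (fun k => blockAvg (P := P) (j := k) (ℰ k)) K U).translate b =
        Averaging.iter (fun k => blockAvg (P := P) (j := k) (ℰ k)) K (U.translate (Site.scaleTo K b)) :=
    fun U => (T4Continuum.iter_translate _ (fun j a V => blockAvg_translate (ℰ j) a V) K b U).symm
  simp_rw [e]
  have hcomp : AEStronglyMeasurable (fun U => Φ (Averaging.iter (fun k => blockAvg (P := P) (j := k) (ℰ k)) K U))
      ((T4GenFunBounds.gibbsMeasure (G := Matrix.specialUnitaryGroup (Fin n) ℂ) P β).map
        (GaugeField.translate (G := Matrix.specialUnitaryGroup (Fin n) ℂ) (Site.scaleTo K b))) :=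
    (hΦ.comp hiter).aestronglyMeasurable
  have := integral_map hT.measurable.aemeasurable hcomp
  rw [hT.map_eq] at this
  exact this.symm

end Invariance

/-! ## §5 A separated mirror family through any plaquette, with the insertion bound -/

section Family

variable {P : Params} {K M N : ℕ} {n : ℕ} [NeZero n] [NeZero N]

/-- **A SEPARATED MIRROR FAMILY THROUGH ANY TOP PLAQUETTE, WITH THE MULTIPLE-REFLECTION BOUND FOR ONE BOUNDED INSERTION** —
the function twin of file 4's `exists_separated_mirror_family`: `SU(n)` Wilson–Gibbs state at `β ≥ 0`, measurable small-loop
averages, height `K ≤ m + K_P`, cubes of side `M ≥ 2` of the level-`K` lattice (`sitesPerDir K = M·N`, `N` even), a measurable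
`g : ℝ → ℝ` with `0 ≤ g ≤ B`.  For EVERY top plaquette `p` there is an injective family `q : BlockIdx P.d N → Plaq P K` of
plaquettes of the directions of `p`, through `p`, pairwise `(M − 1)`-separated in the `ℓ¹` torus distance of base points, with
`∫ g(dist1 Ū^K(∂p)) dGibbs ≤ (∫ ∏_c g(dist1 Ū^K(∂(q c))) dGibbs) ^ (1 ∕ N^d)` (centre `p` by a translation, take the mirror
family, translate back; §3 + §4). [folklore] -/
theorem exists_separated_mirror_family_integral (P : Params) {β : ℝ} (hβ : 0 ≤ β)
    (ℰ : ℕ → LoopAverage (Matrix.specialUnitaryGroup (Fin n) ℂ))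
    (hE : ∀ k l, Measurable fun W : Fin (l + 1) → Matrix.specialUnitaryGroup (Fin n) ℂ => (ℰ k).E W)
    (K : ℕ) (hK : K ≤ P.m + P.K) (h : P.sitesPerDir K = M * N) (hN : Even N) (hM : 2 ≤ M)
    {g : ℝ → ℝ} (hgm : Measurable g) {B : ℝ} (hg0 : ∀ x, 0 ≤ g x) (hgB : ∀ x, g x ≤ B) (p : Plaq P K) :
    ∃ q : BlockIdx P.d N → Plaq P K, Function.Injective q ∧ (∃ c₀, q c₀ = p) ∧
      (∀ c, (q c).μ = p.μ ∧ (q c).ν = p.ν) ∧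
      (∀ c c', c ≠ c' → M - 1 ≤ Site.tdist (q c).src (q c').src) ∧
      ∫ U, g (dist1 (GaugeField.plaqHol
            (Averaging.iter (fun k => blockAvg (P := P) (j := k) (ℰ k)) K U) p))
          ∂(T4GenFunBounds.gibbsMeasure (G := Matrix.specialUnitaryGroup (Fin n) ℂ) P β) ≤
        (∫ U, ∏ c : BlockIdx P.d N, g (dist1 (GaugeField.plaqHol
            (Averaging.iter (fun k => blockAvg (P := P) (j := k) (ℰ k)) K U) (q c)))
          ∂(T4GenFunBounds.gibbsMeasure (G := Matrix.specialUnitaryGroup (Fin n) ℂ) P β)) ^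
          ((1 : ℝ) / (N : ℝ) ^ P.d) := by
  set v : Site P K := centreVec M p with hv
  set p' : Plaq P K := p.translate v with hp'_def
  -- the centred translate satisfies the hypotheses of §2–§3 and of the separation lemma
  have hoff : ∀ j, baseOffset M p' j = centreOffset M p j := fun j => baseOffset_translate_centreVec h p j
  have hp' : ∀ j : Fin P.d, baseOffset M p' j + extent p' j < M := fun j => by
    rw [hoff, hp'_def, extent_translate]; exact (centreOffset_bounds hM p j).1
  have hcen : ∀ j : Fin P.d, M ≤ 2 * baseOffset M p' j + extent p' j + 2 ∧ 2 * baseOffset M p' j + extent p' j ≤ M :=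
    fun j => by rw [hoff, hp'_def, extent_translate]; exact (centreOffset_bounds hM p j).2
  -- the family: mirror copies of the centred translate, translated back
  refine ⟨fun c => (mirror h hN p' c).translate (-v), ?_, ⟨cubeOf M N p'.src, ?_⟩, fun c => ⟨rfl, rfl⟩, ?_, ?_⟩
  · intro c c' hcc'
    apply mirror_injective h hN hp'
    have e : ((mirror h hN p' c).translate (-v)).translate v = ((mirror h hN p' c').translate (-v)).translate v :=
      congrArg (Plaq.translate v) hcc'
    rwa [plaq_translate_translate, plaq_translate_translate, neg_add_cancel, plaq_translate_zero,
      plaq_translate_zero] at e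
  · show (mirror h hN p' (cubeOf M N p'.src)).translate (-v) = p
    rw [mirror_cubeOf h hN hp', hp'_def, plaq_translate_translate, add_neg_cancel, plaq_translate_zero]
  · intro c c' hcc'
    show M - 1 ≤ Site.tdist ((mirror h hN p' c).src + -v) ((mirror h hN p' c').src + -v)
    rw [tdist_add_right]
    exact le_tdist_mirror h hN hp' hcen hcc'
  · -- the bound for `p'` (§3), read back through the translation invariance (§4)
    have main := gibbs_integral_iter_le_rpow_mirror P hβ ℰ hE K hK h hN hgm hg0 hgB p' hp'
    have hΦ₁ : Measurable fun V : GaugeField P K (Matrix.specialUnitaryGroup (Fin n) ℂ) =>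
        g (dist1 (GaugeField.plaqHol V p)) :=
      hgm.comp (RegularGaugeGroup.measurable_dist1.comp (Missing.measurable_plaqHol _))
    have hΦ₂ : Measurable fun V : GaugeField P K (Matrix.specialUnitaryGroup (Fin n) ℂ) =>
        ∏ c : BlockIdx P.d N, g (dist1 (GaugeField.plaqHol V ((mirror h hN p' c).translate (-v)))) :=
      Finset.measurable_prod _ fun c _ =>
        hgm.comp (RegularGaugeGroup.measurable_dist1.comp (Missing.measurable_plaqHol _))
    have e₁ := gibbs_integral_iter_translate P hβ ℰ hE K hΦ₁ v
    have e₂ := gibbs_integral_iter_translate P hβ ℰ hE K hΦ₂ v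
    simp only [GaugeField.plaqHol_translate, plaq_translate_translate, neg_add_cancel, plaq_translate_zero] at e₁ e₂
    rw [← e₁, ← e₂]
    exact main

end Family

end

end Summit.QuantumFields.YangMills.Theorems.LocalInsertion.ChessboardInsertion
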